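import Literature.AlgebraicGeometry.Modules.PullbackFrame
import Literature.AlgebraicGeometry.Modules.RankOneCocycle
import HarnessLib

/-!
# [OURS · L1 W4.5(b) · EL♮(3) (L) brick C2, B3 tools] Transport of `HasRank`: along isomorphisms and under pull-back

Cell res-hironaka, LADDER-RESOLUTION rung L, slot W4.5(b), crux chain w45b: EL♮(3) = stmt-ResolutionOfSingularities-20148, S6 (L) brick C2 of
`Tower.hLift_of_bricks` (res-type-027 g15 C2-CENSUS f661334467642d74 §2: B3 «`ψ^*`/`δ₁^*` transport of classes (`CechPic.pullback`, `FrameSystem.pullback`)»).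
Seat res-D-pv-036 g11 (on-call supplier, classes / `detClass` / `HasRank` lane) — DRAFT BY res-D-pv-036 g11 (parked green 28616788779d56d2 at its
close 00:02Z), filed VERBATIM by res-rescue-typ-5 g3 on the desk's transport re-deal (res-L1-w45b-plan-1 g18 2026-08-28T00:16:05Z / 00:17:40Z). `--supports stmt-ResolutionOfSingularities-20148 --as helper`. OURS; NOT a
statement of any manuscript; AI-written, weaker than expert review. Definition-free; standard axioms.

* `hasRank_of_iso` — `E ≅ E'`, `HasRank E r ⇒ HasRank E' r` (public form of the private plumbing `AbelianVarieties/StructureSheafSemiHomogeneous.hasRank_of_iso'`: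
  transport a constant-rank frame system along the isomorphism restricted to the frames' opens); `hasRank_iff_of_iso`.
* `hasRank_pullback` — `HasRank E r ⇒ HasRank (f^*E) r` for any morphism of schemes `f` (the pulled-back frame system `FrameSystem.pullback` of
  `Modules/PullbackFrame` has the same ranks); `hasRank_of_pullback_iso` (combined form `f^*E ≅ E'`).
[cite: Hartshorne1977, II §5, II Ex. 6.8] [folklore]
-/

noncomputable section

open CategoryTheory AlgebraicGeometry Opposite TopologicalSpace
open Literature.AlgebraicGeometry.Modules Literature.AlgebraicGeometry.Motives

set_option linter.dupNamespace false

namespace Summit.ResolutionOfSingularities.ResolutionOfSingularities.Cruxes.EquisingularLiftNat.Sections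

universe u

variable {X Y : Scheme.{u}}

/-- **Rank is invariant under isomorphism**: `E ≅ E'` and `HasRank E r` give `HasRank E' r` (transport a constant-rank frame system along the
isomorphism restricted to the opens of the frames). [cite: Hartshorne1977, II §5] [folklore] -/
theorem hasRank_of_iso {E E' : X.Modules} (e : E ≅ E') {r : ℕ} (h : HasRank E r) : HasRank E' r := by
  obtain ⟨F, hF⟩ := exists_frameSystem_of_hasRank h
  exact FrameSystem.hasRank
    { U := F.U
      mem := F.mem
      I := F.I
      rank := F.rank
      enum := F.enum
      frame := fun x => F.frame x ≪≫ (Scheme.Modules.overFunctor (F.U x)).mapIso e } r hF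

/-- `HasRank` is invariant under isomorphism (iff form). [cite: Hartshorne1977, II §5] [folklore] -/
theorem hasRank_iff_of_iso {E E' : X.Modules} (e : E ≅ E') (r : ℕ) : HasRank E r ↔ HasRank E' r :=
  ⟨hasRank_of_iso e, hasRank_of_iso e.symm⟩

/-- **Pull-back preserves rank**: if `E` has rank `r` on `Y` then `f^*E` has rank `r` on `X`, for any morphism `f : X ⟶ Y` (the pulled-back
frame system has the same ranks, `FrameSystem.pullback_rank`). [cite: Hartshorne1977, II §5, II Ex. 6.8] [folklore] -/
theorem hasRank_pullback (f : X ⟶ Y) {E : Y.Modules} {r : ℕ} (h : HasRank E r) :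
    HasRank ((Scheme.Modules.pullback f).obj E) r := by
  obtain ⟨F, hF⟩ := exists_frameSystem_of_hasRank h
  exact (F.pullback f).hasRank r fun x => hF (f.base x)

/-- Pull-back preserves rank, combined with an isomorphism `f^*E ≅ E'`. [cite: Hartshorne1977, II §5] [folklore] -/
theorem hasRank_of_pullback_iso (f : X ⟶ Y) {E : Y.Modules} {E' : X.Modules} (e : (Scheme.Modules.pullback f).obj E ≅ E') {r : ℕ}
    (h : HasRank E r) : HasRank E' r :=
  hasRank_of_iso e (hasRank_pullback f h)

end Summit.ResolutionOfSingularities.ResolutionOfSingularities.Cruxes.EquisingularLiftNat.Sections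

end
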